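import Summits.CriticalPhenomena.PercolationContinuityZ3.Theorems.Transplant.FKConnectivityAllQSlackFourPoint
import Summits.CriticalPhenomena.PercolationContinuityZ3.Theorems.Transplant.FKConnectivityAllQCountReweightedCex
import HarnessLib

/-!
# The slack four-point inequality is NOT universal over count weights: kernel refutations of `SlackFourPointBilevelPos` (level pair
# `(3,3)` on a weighted 6-cycle with one chord) and of `SlackFourPointCountPos` (`h = 1{k=3} + 10⁻³`) — while additive gluing holds there

Support file (`--supports stmt-CriticalPhenomena-4575`), FK sub-lane `prim-bschramm-fk-1` (gen 12); builds on p205010 (kernel theorem,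
internal audit signed; external expert review pending).  Computable Boolean predicates and one listed weighted graph; no `Prop` definitions,
no named facts, no sorries; standard axioms (`decide +kernel`).  ERRATUM to the evidence sentences of `SlackFourPointBilevelPos` /
`SlackFourPointCountPos` in `…SlackFourPoint.lean` (written from float censuses on random weights, 0 / 63,540 placements): the EXACT kit
census j133621 (integer weights incl. near-deterministic palettes) found the level-pair statement failing in ≈ 2·10⁻⁵ of the placements with
`|A| = 2` on 6- and 7-vertex graphs (none on the sparser 8-, 9-vertex samples), always at a DIAGONAL cell, hence for a level-concentrated
positive count weight; the smallest witness found by the follow-up search is certified here.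

WITNESS (`SlackCex.d6`).  The 6-cycle `0–2–4–1–3–5–0` with the chord `2–5`; parameters `99/100` on `02, 05, 13, 14, 24, 25` and `1/2` on
`35`; source `o = 2`, relays `a = 4`, `c = 5`, target `b = 1`.  Level-3 product-measure masses (exactly three open clusters):
`x₆ = P({oa|cb} ∩ L₃) = 9801/(2·10¹²)`, `x₇ = P({oc|ab} ∩ L₃) = 49975299/10¹²`, `g₃ = P(({c ↮ b} ∖ F) ∩ L₃) = 2440449/10¹²`,
`g₄ = P(({a ↮ b} ∖ F) ∩ L₃) = 29403/(2·10¹²)`:  `x₆x₇ / (g₃g₄) = 489807905499 / 71756521947 ≈ 6.83 > 1`.  Hence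
**`not_slackFourPointBilevelOn_fin_six`**, **`not_slackFourPointBilevelPos`**; and with the positive count weight `h(3) = 1`, `h(k) = 10⁻³`
otherwise, `μ_h{oa|cb}·μ_h{oc|ab} / (μ_h({c↮b}∖F)·μ_h({a↮b}∖F)) ≈ 1.98 > 1`: **`not_slackFourPointCountPos`**.  In the same cell Kozma–Nitzan's
additive gluing HOLDS under `μ_h` (relay `c` glues, margin `2.5·10⁻⁶`; seat numerics, exact) — consistent with `AdditiveGluingCountPos` /
`MixedLevelGluingPos` (fk-1 g9–g11, 0 failures): for `|A| = 2` NO product-form inequality in a single pair of pattern events (of which SFP is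
the weakest) holds for all positive count weights, although additive gluing does in every census; the surviving mechanism is the mixed-relay
LINEAR statement `MixedLevelGluingPos`.  What survives of SFP: `SlackFourPointFKPos` (random-cluster weights; implied by `FourPointFKPos`,
census-clean), `slackFourPoint_c6` (every `h` on the plain 6-cycle), and the measure-generic reductions of `…SlackFourPoint.lean`.
Memo: bschramm/FROM-fk-1-g12-SLACK-FOURPOINT.md §5.
[cite: KozmaNitzan2024, Conj. 1 (p. 3); Thm. 1, eq. (6) (pp. 7–8)] [cite: Grimmett2006, §1.4 eq. (1.20) (p. 15); §3.9 (pp. 63–65)]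
-/

namespace Summit.CriticalPhenomena.PercolationContinuityZ3.Theorems

namespace FK

open MeasureTheory Set Literature.Probability.LatticeModels Literature.Probability.Percolation

namespace SlackCex

/-- The weighted 6-cycle `0–2–4–1–3–5–0` with chord `2–5` on `Fin 6`: pairs `02, 05, 13, 14, 24, 25, 35`, parameters `99/100` (×6) and `1/2`
(pair `35`); `q = 1` (product measure). [cite: Grimmett2006, §1.4 eq. (1.20) (p. 15)] -/
abbrev d6 : RCEval :=
  ⟨6, 7, ![0, 0, 1, 1, 2, 2, 3], ![2, 5, 3, 4, 4, 5, 5], ![99 / 100, 99 / 100, 99 / 100, 99 / 100, 99 / 100, 99 / 100, 1 / 2], 1⟩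

/-- Validity of the data set. [folklore] -/
theorem valid : d6.Valid := by decide +kernel

/-- `{oa|cb}` (`o = 2, a = 4, c = 5, b = 1`) at level `j`, as a Boolean. [folklore] -/
def p6 (j : ℕ) (t : Finset (Fin 7)) : Bool := ((d6.reachB t 2 4 && d6.reachB t 1 5) && !(d6.reachB t 4 5)) && decide (d6.kB t = j)
/-- `{oc|ab}` at level `j`. [folklore] -/
def p7 (j : ℕ) (t : Finset (Fin 7)) : Bool := ((d6.reachB t 2 5 && d6.reachB t 1 4) && !(d6.reachB t 4 5)) && decide (d6.kB t = j)
/-- `{c ↮ b} ∖ F` at level `j`. [folklore] -/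
def pG3 (j : ℕ) (t : Finset (Fin 7)) : Bool :=
  (!(d6.reachB t 5 1) && !((d6.reachB t 2 4 || d6.reachB t 2 5) && !(d6.reachB t 2 1))) && decide (d6.kB t = j)
/-- `{a ↮ b} ∖ F` at level `j`. [folklore] -/
def pG4 (j : ℕ) (t : Finset (Fin 7)) : Bool :=
  (!(d6.reachB t 4 1) && !((d6.reachB t 2 4 || d6.reachB t 2 5) && !(d6.reachB t 2 1))) && decide (d6.kB t = j)

/-- `P({oa|cb} ∩ L₃) = 9801/(2·10¹²)`. [cite: Grimmett2006, §1.4 eq. (1.20) (p. 15)] -/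
theorem m6 : d6.massQ (p6 3) = 9801 / 2000000000000 := by decide +kernel
/-- `P({oc|ab} ∩ L₃) = 49975299/10¹²`. [cite: Grimmett2006, §1.4 eq. (1.20) (p. 15)] -/
theorem m7 : d6.massQ (p7 3) = 49975299 / 1000000000000 := by decide +kernel
/-- `P(({c ↮ b} ∖ F) ∩ L₃) = 2440449/10¹²`. [cite: Grimmett2006, §1.4 eq. (1.20) (p. 15)] -/
theorem mG3 : d6.massQ (pG3 3) = 2440449 / 1000000000000 := by decide +kernel
/-- `P(({a ↮ b} ∖ F) ∩ L₃) = 29403/(2·10¹²)`. [cite: Grimmett2006, §1.4 eq. (1.20) (p. 15)] -/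
theorem mG4 : d6.massQ (pG4 3) = 29403 / 2000000000000 := by decide +kernel
/-- Total mass `Z = 1` (product measure). [folklore] -/
theorem z_eq : d6.ZQ = 1 := by decide +kernel

/-- The level-concentrated positive count weight `h(3) = 1`, `h(k) = 1/1000` otherwise (rational side). [folklore] -/
def hQ (k : ℕ) : ℚ := if k = 3 then 1 else 1 / 1000

/-- `{oa|cb}` as a Boolean (no level). [folklore] -/
def q6 (t : Finset (Fin 7)) : Bool := (d6.reachB t 2 4 && d6.reachB t 1 5) && !(d6.reachB t 4 5)
/-- `{oc|ab}` as a Boolean. [folklore] -/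
def q7 (t : Finset (Fin 7)) : Bool := (d6.reachB t 2 5 && d6.reachB t 1 4) && !(d6.reachB t 4 5)
/-- `{c ↮ b} ∖ F` as a Boolean. [folklore] -/
def qG3 (t : Finset (Fin 7)) : Bool := !(d6.reachB t 5 1) && !((d6.reachB t 2 4 || d6.reachB t 2 5) && !(d6.reachB t 2 1))
/-- `{a ↮ b} ∖ F` as a Boolean. [folklore] -/
def qG4 (t : Finset (Fin 7)) : Bool := !(d6.reachB t 4 1) && !((d6.reachB t 2 4 || d6.reachB t 2 5) && !(d6.reachB t 2 1))

/-- `μ_h`-masses (unnormalised): `{oa|cb}`. [cite: Grimmett2006, §1.4 eq. (1.20) (p. 15)] -/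
theorem mh6 : d6.masshQ hQ q6 = 5870799 / 1000000000000000 := by decide +kernel
/-- `{oc|ab}`. [cite: Grimmett2006, §1.4 eq. (1.20) (p. 15)] -/
theorem mh7 : d6.masshQ hQ q7 = 109847657601 / 2000000000000000 := by decide +kernel
/-- `{c ↮ b} ∖ F`. [cite: Grimmett2006, §1.4 eq. (1.20) (p. 15)] -/
theorem mhG3 : d6.masshQ hQ qG3 = 5075017301 / 2000000000000000 := by decide +kernel
/-- `{a ↮ b} ∖ F`. [cite: Grimmett2006, §1.4 eq. (1.20) (p. 15)] -/
theorem mhG4 : d6.masshQ hQ qG4 = 4012303 / 62500000000000 := by decide +kernel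
/-- `Z_h`. [cite: Grimmett2006, §1.4 eq. (1.20) (p. 15)] -/
theorem zh_eq : d6.ZhQ hQ = 1153712033101 / 1000000000000000 := by decide +kernel

noncomputable section

open scoped Classical

/-- Pattern membership `{oa|cb}` in Boolean form. [folklore] -/
theorem mem_q6 (t : Finset (Fin 7)) :
    d6.conf t ∈ (openConn (2 : Fin 6) 4 ∩ openConn (1 : Fin 6) 5 ∩ sepEv (4 : Fin 6) 5 : Set (BondConfig (Fin 6))) ↔ q6 t = true := by
  have e24 := d6.reachB_iff t 2 4
  have e15 := d6.reachB_iff t 1 5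
  have e45 := d6.reachB_iff t 4 5
  simp only [q6, Set.mem_inter_iff, mem_sepEv_iff, mem_openConn_iff', ← e24, ← e15, ← e45]
  cases d6.reachB t 2 4 <;> cases d6.reachB t 1 5 <;> cases d6.reachB t 4 5 <;> simp

/-- Pattern membership `{oc|ab}` in Boolean form. [folklore] -/
theorem mem_q7 (t : Finset (Fin 7)) :
    d6.conf t ∈ (openConn (2 : Fin 6) 5 ∩ openConn (1 : Fin 6) 4 ∩ sepEv (4 : Fin 6) 5 : Set (BondConfig (Fin 6))) ↔ q7 t = true := by
  have e25 := d6.reachB_iff t 2 5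
  have e14 := d6.reachB_iff t 1 4
  have e45 := d6.reachB_iff t 4 5
  simp only [q7, Set.mem_inter_iff, mem_sepEv_iff, mem_openConn_iff', ← e25, ← e14, ← e45]
  cases d6.reachB t 2 5 <;> cases d6.reachB t 1 4 <;> cases d6.reachB t 4 5 <;> simp

/-- Membership `{c ↮ b} ∖ F` in Boolean form. [folklore] -/
theorem mem_qG3 (t : Finset (Fin 7)) :
    d6.conf t ∈ ((openConn (5 : Fin 6) 1)ᶜ \ glueDefect (2 : Fin 6) 4 5 1 : Set (BondConfig (Fin 6))) ↔ qG3 t = true := by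
  have e51 := d6.reachB_iff t 5 1
  have e24 := d6.reachB_iff t 2 4
  have e25 := d6.reachB_iff t 2 5
  have e21 := d6.reachB_iff t 2 1
  simp only [glueDefect, qG3, Set.mem_sdiff, Set.mem_compl_iff, Set.mem_union, mem_openConn_iff', ← e51, ← e24, ← e25, ← e21]
  cases d6.reachB t 5 1 <;> cases d6.reachB t 2 4 <;> cases d6.reachB t 2 5 <;> cases d6.reachB t 2 1 <;> simp

/-- Membership `{a ↮ b} ∖ F` in Boolean form. [folklore] -/
theorem mem_qG4 (t : Finset (Fin 7)) :
    d6.conf t ∈ ((openConn (4 : Fin 6) 1)ᶜ \ glueDefect (2 : Fin 6) 4 5 1 : Set (BondConfig (Fin 6))) ↔ qG4 t = true := by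
  have e41 := d6.reachB_iff t 4 1
  have e24 := d6.reachB_iff t 2 4
  have e25 := d6.reachB_iff t 2 5
  have e21 := d6.reachB_iff t 2 1
  simp only [glueDefect, qG4, Set.mem_sdiff, Set.mem_compl_iff, Set.mem_union, mem_openConn_iff', ← e41, ← e24, ← e25, ← e21]
  cases d6.reachB t 4 1 <;> cases d6.reachB t 2 4 <;> cases d6.reachB t 2 5 <;> cases d6.reachB t 2 1 <;> simp

/-- Level versions of the four memberships. [folklore] -/
theorem mem_p6 (j : ℕ) (t : Finset (Fin 7)) :
    d6.conf t ∈ (openConn (2 : Fin 6) 4 ∩ openConn (1 : Fin 6) 5 ∩ sepEv (4 : Fin 6) 5 ∩ levelSet (Fin 6) j : Set (BondConfig (Fin 6))) ↔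
      p6 j t = true := by
  rw [Set.mem_inter_iff, mem_levelSet_iff, RCEval.clusterCount_conf, mem_q6]
  simp [p6, q6]

/-- Level version, `{oc|ab}`. [folklore] -/
theorem mem_p7 (j : ℕ) (t : Finset (Fin 7)) :
    d6.conf t ∈ (openConn (2 : Fin 6) 5 ∩ openConn (1 : Fin 6) 4 ∩ sepEv (4 : Fin 6) 5 ∩ levelSet (Fin 6) j : Set (BondConfig (Fin 6))) ↔
      p7 j t = true := by
  rw [Set.mem_inter_iff, mem_levelSet_iff, RCEval.clusterCount_conf, mem_q7]
  simp [p7, q7]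

/-- Level version, `{c ↮ b} ∖ F`. [folklore] -/
theorem mem_pG3 (j : ℕ) (t : Finset (Fin 7)) :
    d6.conf t ∈ (((openConn (5 : Fin 6) 1)ᶜ \ glueDefect (2 : Fin 6) 4 5 1) ∩ levelSet (Fin 6) j : Set (BondConfig (Fin 6))) ↔
      pG3 j t = true := by
  rw [Set.mem_inter_iff, mem_levelSet_iff, RCEval.clusterCount_conf, mem_qG3]
  simp [pG3, qG3]

/-- Level version, `{a ↮ b} ∖ F`. [folklore] -/
theorem mem_pG4 (j : ℕ) (t : Finset (Fin 7)) :
    d6.conf t ∈ (((openConn (4 : Fin 6) 1)ᶜ \ glueDefect (2 : Fin 6) 4 5 1) ∩ levelSet (Fin 6) j : Set (BondConfig (Fin 6))) ↔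
      pG4 j t = true := by
  rw [Set.mem_inter_iff, mem_levelSet_iff, RCEval.clusterCount_conf, mem_qG4]
  simp [pG4, qG4]

/-- The product measure of the data set as an `RCEval` measure (`q = 1`). [cite: Grimmett2006, §1.2 (p. 4)] -/
theorem prodBernoulli_eq : prodBernoulli d6.w = rcMeasureW d6.w ((d6.q : ℚ) : ℝ) ∅ := by
  rw [show ((d6.q : ℚ) : ℝ) = 1 by norm_num, rcMeasureW_one]

/-- The real count weight and its rational side agree. [folklore] -/
theorem h_eq (k : ℕ) : (fun k : ℕ => if k = 3 then (1 : ℝ) else 1 / 1000) k = ((hQ k : ℚ) : ℝ) := by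
  unfold hQ
  by_cases hk : k = 3
  · simp [hk]
  · simp [hk]

/-- The count weight is positive. [folklore] -/
theorem h_pos (k : ℕ) : 0 < (fun k : ℕ => if k = 3 then (1 : ℝ) else 1 / 1000) k := by
  show 0 < (if k = 3 then (1 : ℝ) else 1 / 1000)
  split_ifs <;> norm_num

end

end SlackCex

noncomputable section

open scoped Classical
open SlackCex

/-- **The bilevel slack four-point statement fails on `Fin 6`** at the diagonal cell `(3,3)` of the witness:
`2·x₆x₇ = 2·(9801/2·10¹²)(49975299/10¹²) > 2·(2440449/10¹²)(29403/2·10¹²) = 2·g₃g₄`. [cite: KozmaNitzan2024, Thm. 1 (p. 7)]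
[cite: Grimmett2006, §1.4 eq. (1.20) (p. 15)] -/
theorem not_slackFourPointBilevelOn_fin_six : ¬ SlackFourPointBilevelOn (Fin 6) := by
  intro hB
  have key := hB d6.w 2 4 5 1 3 3
  have hZ : (0 : ℝ) < (d6.ZQ : ℝ) := RCEval.zQ_pos valid
  rw [prodBernoulli_eq, RCEval.real_eq_massQ_div valid (P := p6 3) (mem_p6 3), RCEval.real_eq_massQ_div valid (P := p7 3) (mem_p7 3),
    RCEval.real_eq_massQ_div valid (P := pG3 3) (mem_pG3 3), RCEval.real_eq_massQ_div valid (P := pG4 3) (mem_pG4 3),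
    m6, m7, mG3, mG4, z_eq] at key
  push_cast at key
  norm_num at key

/-- **`¬ SlackFourPointBilevelPos`** (ERRATUM to the evidence line of that node: its exact status is 'fails in ≈ 2·10⁻⁵ of |A| = 2 placements on
6–7-vertex graphs, kit j133621'). [cite: KozmaNitzan2024, Thm. 1 (p. 7)] -/
theorem not_slackFourPointBilevelPos : ¬ SlackFourPointBilevelPos := fun h => not_slackFourPointBilevelOn_fin_six (h 6)

/-- **The slack four-point inequality fails for a positive count weight**: with `h(3) = 1`, `h(k) = 10⁻³` (`k ≠ 3`) on the witness,
`μ_h{oa|cb}·μ_h{oc|ab} > μ_h({c ↮ b} ∖ F)·μ_h({a ↮ b} ∖ F)` (ratio ≈ 1.98).  So `¬ SlackFourPointCountPos`: for `|A| = 2` no single-pair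
product inequality holds under ALL count weights, although additive gluing has no counterexample there (`AdditiveGluingCountPos`; in this very
cell relay `c` glues). [cite: KozmaNitzan2024, Conj. 1 (p. 3); Thm. 1 (p. 7)] [cite: Grimmett2006, §3.9 (pp. 63–65)] -/
theorem not_slackFourPointCountPos : ¬ SlackFourPointCountPos := by
  intro H
  have key := H 6 d6.w (fun k => if k = 3 then (1 : ℝ) else 1 / 1000) h_pos 2 4 5 1
  unfold SlackFourPointUnder at key
  rw [RCEval.cr_real_eq_masshQ_div valid h_eq h_pos (P := q6) mem_q6, RCEval.cr_real_eq_masshQ_div valid h_eq h_pos (P := q7) mem_q7,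
    RCEval.cr_real_eq_masshQ_div valid h_eq h_pos (P := qG3) mem_qG3, RCEval.cr_real_eq_masshQ_div valid h_eq h_pos (P := qG4) mem_qG4,
    mh6, mh7, mhG3, mhG4, zh_eq] at key
  push_cast at key
  norm_num at key

end

end FK

end Summit.CriticalPhenomena.PercolationContinuityZ3.Theorems
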